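import Mathlib.Combinatorics.SetFamily.Compression.Down
import Mathlib.Tactic
import HarnessLib
import HarnessLib.Audit.Tags
import Summits.CriticalPhenomena.PercolationContinuityZ3.Theorems.PercNearOneGluingNoHeavyLowerTailSahiRainbowTwoColourDeficitDefs

/-!
# The sparse residual is LOCAL, II: an S₁-point excludes every S₂-point (collisions and the L-cases)

Support file (seat `prim-masterthm-p1`, gen 42; `--supports stmt-CriticalPhenomena-4575`).  No `sorry`, standard axioms.
Blueprint `run/shared/lean/prim/prim-masterthm/FROM-prim-masterthm-p1-g42-*.md` (PROOFS §1–§2).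

SETTING (`…SahiRainbowTwoColourDeficitDefs`): `Z = X ⊔ Y ⊆ 2^G` complement-closed, `L = monoMeets X Y`; an S₁-point `y₁`
(`S1At X Y G y₁ P Q`: upper members `P ∈ X`, `Q ∈ Y` with `P ∩ Q = {y₁}`, `P ∪ Q = G`, lower members `P ∖ y₁`, `Q ∖ y₁ ∈ Z`,
`{y₁} ∉ L`, no non-empty twin at `y₁`) and an S₂-point `y₂` (a D-point `DAt` or a Q-point `Q3At`: `{y₂} ∈ L`, no non-empty
twin at `y₂`, monochromatic bisections among the upper members).

THIS FILE (S₁ versus S₂, first half):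
* `coll_left` / `coll_right` (**COLL**): a same-coloured collision `a, insert y a` and a third member of that colour through
  `y` force a non-empty twin at `y` or the colour `{{y}}` — absurd at an S₁-point;
* the **L-cases**: if the S₁-point `y₁` has a collision below `P` (`P ∖ y₁ ∈ X`) then no `X`-member other than `P` passes
  through `y₁`; a monochromatic `X`-bisection at `y₂` then passes through `P`, and `P ∖ y₂` produces a twin at `y₁` or the
  colour `{{y₁}}` (`S1At.false_of_Lx_memX`, `…_bisectX`, `…_Q3opp`); dually for a collision below `Q` (`…_Ly_memY`, `…_Ly_bisectY`).
HONEST FRAMING: unconditional combinatorial lemmas (the local three-direction analysis of the sparse residual). [this work]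
-/

namespace Summit.CriticalPhenomena.PercolationContinuityZ3.Theorems.SahiColouredDaykin

open Finset
open scoped FinsetFamily

variable {α : Type*} [DecidableEq α]

/-! ### M1. Facts about an S₁-point -/

section S1Facts

variable {X Y : Finset (Finset α)} {G : Finset α} {y : α} {P Q : Finset α}

/-- The bicoloured bisection of an S₁-point as a `Bisect` in the whole family. [this work] -/
theorem S1At.toBisect (h : S1At X Y G y P Q) : Bisect (X ∪ Y) (X ∪ Y) G y P Q :=
  ⟨mem_union_left _ h.memP, mem_union_right _ h.memQ, h.y_mem_P, h.y_mem_Q, h.inter_eq, h.union_eq, h.erase_P, h.erase_Q⟩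

/-- `Q = insert y (G ∖ P)`. [this work] -/
theorem S1At.Q_eq (h : S1At X Y G y P Q) : Q = insert y (G \ P) := h.toBisect.eq_insert_sdiff

/-- `P = insert y (G ∖ Q)`. [this work] -/
theorem S1At.P_eq (h : S1At X Y G y P Q) : P = insert y (G \ Q) := h.toBisect.swap.eq_insert_sdiff

/-- `Q.erase y = G ∖ P`. [this work] -/
theorem S1At.erase_Q_eq (h : S1At X Y G y P Q) : Q.erase y = G \ P := by
  rw [h.Q_eq, erase_insert]; exact fun h' => (mem_sdiff.1 h').2 h.y_mem_P

/-- `P.erase y = G ∖ Q`. [this work] -/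
theorem S1At.erase_P_eq (h : S1At X Y G y P Q) : P.erase y = G \ Q := by
  rw [h.P_eq, erase_insert]; exact fun h' => (mem_sdiff.1 h').2 h.y_mem_Q

/-- `P ⊆ G`. [this work] -/
theorem S1At.P_subset (h : S1At X Y G y P Q) : P ⊆ G := h.toBisect.subset

/-- `Q ⊆ G`. [this work] -/
theorem S1At.Q_subset (h : S1At X Y G y P Q) : Q ⊆ G := h.toBisect.swap.subset

/-- A point of `P` other than `y` is not in `Q`. [this work] -/
theorem S1At.notMem_Q (h : S1At X Y G y P Q) {t : α} (htP : t ∈ P) (hty : t ≠ y) : t ∉ Q := by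
  intro htQ
  have : t ∈ P ∩ Q := mem_inter.2 ⟨htP, htQ⟩
  rw [h.inter_eq, mem_singleton] at this; exact hty this

/-- A point of `G` not in `P` is in `Q`. [this work] -/
theorem S1At.mem_Q_of_notMem_P (h : S1At X Y G y P Q) {t : α} (htG : t ∈ G) (htP : t ∉ P) : t ∈ Q := by
  rw [h.Q_eq, mem_insert, mem_sdiff]; exact Or.inr ⟨htG, htP⟩

/-- `P ≠ Q`. [this work] -/
theorem S1At.P_ne_Q (h : S1At X Y G y P Q) (hXY : Disjoint X Y) : P ≠ Q :=
  fun e => disjoint_left.1 hXY h.memP (e ▸ h.memQ)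

end S1Facts

/-! ### M2. Collisions -/

section Coll

variable {X Y : Finset (Finset α)} {y : α}

/-- Intersecting with `insert y a` for `y ∈ t`. [this work] -/
theorem inter_insert_eq {t a : Finset α} (hyt : y ∈ t) : t ∩ insert y a = insert y (t ∩ a) :=
  inter_insert_of_mem hyt

/-- **COLL.**  A collision `a, insert y a ∈ X` and a third member `t ∈ X` through `y`: then `t ∩ a` is a non-empty twin at `y`,
or `{y}` is a colour.  So at a point with `NoTwin` and `{y} ∉ L` this is absurd. [this work] -/
theorem coll_left {a t : Finset α} (ha : a ∈ X) (ha' : insert y a ∈ X) (hya : y ∉ a) (ht : t ∈ X) (hyt : y ∈ t)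
    (hne : t ≠ insert y a) (hsing : {y} ∉ monoMeets X Y) (htw : NoTwin (monoMeets X Y) y) : False := by
  have hta : t ≠ a := fun h => hya (h ▸ hyt)
  have c_mem : t ∩ a ∈ monoMeets X Y := inter_mem_monoMeets_left ht ha hta
  have c'_mem : insert y (t ∩ a) ∈ monoMeets X Y := by
    rw [← inter_insert_of_mem hyt]; exact inter_mem_monoMeets_left ht ha' hne
  have hc := htw c_mem c'_mem (fun h => hya (mem_inter.1 h).2)
  rw [hc, insert_empty] at c'_mem
  exact hsing c'_mem

/-- **COLL** in the second class. [this work] -/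
theorem coll_right {a t : Finset α} (ha : a ∈ Y) (ha' : insert y a ∈ Y) (hya : y ∉ a) (ht : t ∈ Y) (hyt : y ∈ t)
    (hne : t ≠ insert y a) (hsing : {y} ∉ monoMeets X Y) (htw : NoTwin (monoMeets X Y) y) : False := by
  rw [monoMeets_comm] at hsing htw
  exact coll_left (X := Y) (Y := X) ha ha' hya ht hyt hne hsing htw

end Coll

/-! ### M3. An S₁-point and an S₂-point cannot coexist: the L-cases -/

section MixL

variable {X Y : Finset (Finset α)} {G : Finset α} {y₁ y₂ : α} {P Q : Finset α}

/-- L-case core: S₁ at `y₁` with `P ∖ y₁ ∈ X` (an `X`-collision below `P`), and an `X`-member `V` containing `y₁` and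
`y₂ ≠ y₁` with `V ∖ y₂ ∈ Z`: absurd (given a third point).  By COLL `V = P`; then `P ∖ y₂ ∈ X` gives the twin `P ∖ {y₁,y₂}` at
`y₁` and `P ∖ y₂ ∈ Y` gives the colour `{y₁} = Q ∩ (P ∖ y₂)`. [this work] -/
theorem S1At.false_of_Lx_memX (h₁ : S1At X Y G y₁ P Q) (hL : P.erase y₁ ∈ X) (hne : y₁ ≠ y₂)
    (hG3 : ∃ t ∈ G, t ≠ y₁ ∧ t ≠ y₂) {V : Finset α} (hVX : V ∈ X) (hy₂V : y₂ ∈ V) (hVe : V.erase y₂ ∈ X ∪ Y)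
    (hy₁V : y₁ ∈ V) : False := by
  have hPe : insert y₁ (P.erase y₁) = P := insert_erase h₁.y_mem_P
  -- `V = P` by COLL
  by_cases hVP : V ≠ P
  · exact coll_left hL (hPe.symm ▸ h₁.memP) (notMem_erase y₁ P) hVX hy₁V (by rwa [hPe]) h₁.singleton_notMem
      h₁.noTwin
  push Not at hVP
  subst hVP
  -- colour of `P ∖ y₂`
  rcases mem_union.1 hVe with hX | hY
  · -- twin `P ∖ {y₁,y₂}` at `y₁`
    have ne1 : V.erase y₂ ≠ V.erase y₁ := by
      intro e; have : y₁ ∈ V.erase y₂ := mem_erase.2 ⟨hne, h₁.y_mem_P⟩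
      rw [e] at this; exact (notMem_erase y₁ V) this
    have c_mem : V.erase y₂ ∩ V.erase y₁ ∈ monoMeets X Y := inter_mem_monoMeets_left hX hL ne1
    have ne2 : V ≠ V.erase y₂ := fun e => (notMem_erase y₂ V) (e ▸ hy₂V)
    have c'_mem : V ∩ V.erase y₂ ∈ monoMeets X Y := inter_mem_monoMeets_left hVX hX ne2
    have e1 : V ∩ V.erase y₂ = insert y₁ (V.erase y₂ ∩ V.erase y₁) := by
      ext t; simp only [mem_inter, mem_erase, mem_insert]
      constructor
      · rintro ⟨htV, hty2, -⟩
        by_cases h : t = y₁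
        · exact Or.inl h
        · exact Or.inr ⟨⟨hty2, htV⟩, h, htV⟩
      · rintro (rfl | ⟨⟨hty2, htV⟩, -, -⟩)
        · exact ⟨h₁.y_mem_P, hne, h₁.y_mem_P⟩
        · exact ⟨htV, hty2, htV⟩
    rw [e1] at c'_mem
    have hc := h₁.noTwin c_mem c'_mem (fun h => (notMem_erase y₁ V) (mem_inter.1 h).2)
    rw [hc, insert_empty] at c'_mem
    exact h₁.singleton_notMem c'_mem
  · -- `Q ∩ (P ∖ y₂) = {y₁}`
    have ne1 : Q ≠ V.erase y₂ := by
      intro e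
      obtain ⟨t, htG, ht1, ht2⟩ := hG3
      by_cases htP : t ∈ V
      · exact h₁.notMem_Q htP ht1 (e.symm ▸ mem_erase.2 ⟨ht2, htP⟩)
      · have htQ := h₁.mem_Q_of_notMem_P htG htP
        rw [e] at htQ; exact htP (mem_of_mem_erase htQ)
    have c_mem : Q ∩ V.erase y₂ ∈ monoMeets X Y := inter_mem_monoMeets_right h₁.memQ hY ne1
    have e1 : Q ∩ V.erase y₂ = {y₁} := by
      ext t; simp only [mem_inter, mem_erase, mem_singleton]
      constructor
      · rintro ⟨htQ, -, htV⟩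
        by_contra h; exact h₁.notMem_Q htV h htQ
      · rintro rfl; exact ⟨h₁.y_mem_Q, hne, h₁.y_mem_P⟩
    rw [e1] at c_mem
    exact h₁.singleton_notMem c_mem

/-- L-case with an `X`-bisection at `y₂` (either member may contain `y₁`). [this work] -/
theorem S1At.false_of_Lx_bisectX (h₁ : S1At X Y G y₁ P Q) (hL : P.erase y₁ ∈ X) (hne : y₁ ≠ y₂)
    (hG3 : ∃ t ∈ G, t ≠ y₁ ∧ t ≠ y₂) {V V' : Finset α} (hV : Bisect X (X ∪ Y) G y₂ V V') : False := by
  by_cases hy₁V : y₁ ∈ V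
  · exact h₁.false_of_Lx_memX hL hne hG3 hV.mem hV.y_mem hV.erase_mem hy₁V
  · have : y₁ ∈ V' := by rw [hV.mem'_iff]; exact Or.inr ⟨h₁.P_subset h₁.y_mem_P, hy₁V⟩
    exact h₁.false_of_Lx_memX hL hne hG3 hV.mem' hV.y_mem' hV.erase_mem' this

/-- L-case against a Q-point of the opposite orientation (`{y₂} ∈ Y`, `G ∈ X`, `Y`-bisection). [this work] -/
theorem S1At.false_of_Lx_Q3opp (h₁ : S1At X Y G y₁ P Q) (hL : P.erase y₁ ∈ X) (hne : y₁ ≠ y₂)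
    {C C' : Finset α} (h₂ : Q3At Y X G y₂ C C') : False := by
  have hPe : insert y₁ (P.erase y₁) = P := insert_erase h₁.y_mem_P
  have hyG : y₁ ∈ G := h₁.P_subset h₁.y_mem_P
  by_cases hGP : G ≠ P
  · exact coll_left hL (hPe.symm ▸ h₁.memP) (notMem_erase y₁ P) h₂.univ_mem hyG (by rwa [hPe]) h₁.singleton_notMem
      h₁.noTwin
  push Not at hGP
  -- `Q = {y₁}` and the `Y`-bisection member through `y₁` meets it in `{y₁}`
  have hQ : Q = {y₁} := by rw [h₁.Q_eq, hGP, sdiff_self]; rfl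
  have key : ∀ {W W' : Finset α}, Bisect Y (Y ∪ X) G y₂ W W' → y₁ ∈ W → False := by
    intro W W' hW hy₁W
    have ne : Q ≠ W := by
      intro e; have := hW.y_mem; rw [← e, hQ, mem_singleton] at this; exact hne this.symm
    have := inter_mem_monoMeets_right (X := X) h₁.memQ hW.mem ne
    rw [hQ, singleton_inter_of_mem hy₁W] at this
    exact h₁.singleton_notMem this
  by_cases hy₁C : y₁ ∈ C
  · exact key h₂.bis hy₁C
  · have : y₁ ∈ C' := by rw [h₂.bis.mem'_iff]; exact Or.inr ⟨hyG, hy₁C⟩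
    exact key h₂.bis.swap this

/-- Ly-case core: S₁ at `y₁` with `Q ∖ y₁ ∈ Y` (a `Y`-collision below `Q`) and `y₂ ∈ P`: then NO `Y`-member other than
`Q` contains `y₁`; in particular no `Y`-bisection at `y₂` and `G ∉ Y`. [this work] -/
theorem S1At.false_of_Ly_memY (h₁ : S1At X Y G y₁ P Q) (hLy : Q.erase y₁ ∈ Y) (hne : y₁ ≠ y₂) (hy₂P : y₂ ∈ P)
    {W : Finset α} (hW : W ∈ Y) (hy₁W : y₁ ∈ W) (hy₂W : y₂ ∈ W) : False := by
  have hQe : insert y₁ (Q.erase y₁) = Q := insert_erase h₁.y_mem_Q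
  have ne : W ≠ Q := fun e => h₁.notMem_Q hy₂P hne.symm (e ▸ hy₂W)
  exact coll_right hLy (hQe.symm ▸ h₁.memQ) (notMem_erase y₁ Q) hW hy₁W (by rwa [hQe]) h₁.singleton_notMem h₁.noTwin

/-- Ly-case with a `Y`-bisection at `y₂`. [this work] -/
theorem S1At.false_of_Ly_bisectY (h₁ : S1At X Y G y₁ P Q) (hLy : Q.erase y₁ ∈ Y) (hne : y₁ ≠ y₂) (hy₂P : y₂ ∈ P)
    {W W' : Finset α} (hW : Bisect Y (X ∪ Y) G y₂ W W') : False := by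
  by_cases hy₁W : y₁ ∈ W
  · exact h₁.false_of_Ly_memY hLy hne hy₂P hW.mem hy₁W hW.y_mem
  · have : y₁ ∈ W' := by rw [hW.mem'_iff]; exact Or.inr ⟨h₁.P_subset h₁.y_mem_P, hy₁W⟩
    exact h₁.false_of_Ly_memY hLy hne hy₂P hW.mem' this hW.y_mem'

end MixL


end Summit.CriticalPhenomena.PercolationContinuityZ3.Theorems.SahiColouredDaykin
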